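/- Copyright: the b2b-balaban cell (near-miss cell 7), T⁴-continuum fan-out, row NE7b CRUX team (2), seat
`t4-ne7b-formalise-leaf-03` (gen 129) — typist's build of the OWNER's INTERFACE REQUEST NE7b IR-103-1 «THE END RE-CUT AT THE PER-CLASS
RELATIVE DISPLAY» (OWNER `t4-ne7b-p1` g103, rulings W-ne7bp1-g103-1 §4 (3) ∕ W-ne7bp1-g103-2 (4); memo
`t4/b2b-balaban-t4-ne7b-p1/g103/F-RHO-TOWER-g103.md`), part 1 of 2: the record.  Released under the licence of the surrounding project. -/
import Summits.QuantumFields.BalabanUV.T4Continuum.Support.B16HistoryTowerStepRangeDataLWR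

/-!
# (α)-INSTANCE — THE END AT THE TOWER, RE-CUT AT THE PER-PINNED-CLASS RELATIVE DISPLAY, part 1: the record
`TowerExtractionDataLWR` = IR-102-2's `TowerStepRangeDataLWR` (p350832) MINUS the dressing sup letters and the term-wise ∕ by-volume
numerator rows of both runs, PLUS the two runs' EXTRACTION displays per pinned old genealogy and the cell's COUNT in relative currency

Summits-side support leaf of the T⁴-continuum cell (rung (B)+1 on a FINITE torus only; NOT infinite volume, NOT the mass gap, NOT
Clay; NOT a proof of NE7b — the cell's OWN estimate `T4WeightBudget.RelWeightBound`, NOT PRINTED, NOT PROVED).  [folklore] ONE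
`structure` (a hypothesis SHAPE: data + located displays + C-side letters, NOTHING of Bałaban's asserted); no `[cite:]` tag, no `Prop`
minted, zero `sorry`.  INTERFACE REQUEST NE7b IR-103-1 (OWNER `t4-ne7b-p1` g103; typist leaf-03 g129, INTENT I-leaf03-g129-1, journal
l.50091); part 2 (`B16HistoryTowerExtractionEnd`) carries the road `continuumYM4Torus_of_towerExtraction_fsc`.  The sibling records
(`TowerStepRangeDataLWR`, `TowerStepDataLWR`, 1R `TowerReadDataLWR`, the non-tower `HistReadDataLWL ∕ LWR`) stay in the tree as kernel
objects; the OWNER withdrew them as «the road of record for Bałaban's run» (W-ne7bp1-g103-1 (1)).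

WHY (the OWNER's located findings F-ne7bp1-g103-1 ∕ -2, memo §§1–2; the refuter's F325; leaf-02 g117's (T1)–(T3) — checkable arithmetic
over the tree's own declarations, zero weight on rank ∕ price).  The sibling END reaches the per-key partial sum `Σ_{τ ∈ fibre k} weight τ`
through TERM-WISE sup-norm factors (M2-B `weight ≤ dead·LIVE·rest`, `rest ≤ e^{BA}·mass·W`) and the by-VOLUME display (ρ), with K-UNIFORM
envelope letters `hBA : log (B K t) ≤ BA∞` and `hWi : W K ≤ W∞`.  At the INTENDED instance both fail: `hBA` at every cutoff (the END's own
(γ)-floor and site letters force `B K t ≥ e^{−ē·n₁−l₀}·c₀ ∕ Z_K` with `−log Z_K ≍ L^{4K}` — the bare-field entropy), `hWi` asymptotically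
(the fibre of a live key contains every history differing from it by FREE DEAD large-field cubes; in print those parts are exponentiated
at the same step, [Balaban1989LargeFieldII] (1.90)–(1.98) pp. 388–390, (1.101) p. 390, never summation labels).  What Bałaban's method CAN
give is the partial-sum statement itself, RELATIVE to the full sum, per pinned old genealogy `k`:
`Σ_{τ ∈ fibre k} A K t τ ≤ q K k · Σ_{T K} A K t τ` — `Spine/NE7b/PinnedExtraction.ExtractionLaws.extract` (p352727).  RULING
W-ne7bp1-g103-2 (4): the (α) road is RE-CUT there; this record is its INPUT SHAPE at the tower.

INDEX CONVENTION (C-ρ-TOWER, ruling W-ne7bp1-g103-2 (1); words, no field): the tower is read AT PRINT's LIVE INDEX — `(T K).branch j g`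
ranges over print's LIVE outcomes only (new regions ∕ renewals ∕ mergers of LIVE components); the second-group 𝐑-outputs and healings of
step `j` are folded into `(T K).op j g p` (its density factor carries `exp Σ_X R′^{(j)}(X)` and the counterterms, (1.98) ∕ (1.101)); on read
terms `histV.died j = ∅` by construction.  (ρ) «at the tower» is NOT specced (dead by F-ne7bp1-g103-1).

WHAT.  `TowerStepRangeDataLWR` FIELD FOR FIELD with:
* STRUCK (the ruling's list verbatim): the dressing sup letters `B hB hBρ hBA mi hmi`; the (ρ) ∕ envelope ∕ share rows of run A
  `W one_le_W Wi hWi hρ φB φR hφB hφR`; run B's term-wise ∕ by-volume rows and letters `dB mup sB' φB' φR' upB deadB_nonneg resumB mup_bd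
  hφB' hφR' hsB'`;
* STRUCK AFTER THE RULING's «(γ)∕sites — check» (typist's located check C-2, INTENT l.50091): `c₀ n₁ c₀_pos floor floor' sites sites'` —
  part 2's road reads NO floor (the seam `CountSeamJunction.hybridNE7_of_eventually`, the structure-free apex step
  `HistoryRealiseCellsRunApexT3b.stringHybridNE7_of_hybridNE7_repr` and `T4ApexHybrid.targets_of_hybridNE7Under` take none; the (2.50)
  floor of the sibling road was `GlobalDom.low`, which now sits INSIDE the relative display `extract`);
* THE REPRESENTATION LETTER (typist's located choice C-1): `B16HistoryReprInstance.reprFam T p₀ ρ₀ hρ₀ h0 B hB` wants SOME positive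
  letter; with `B hB` struck the record's `intA`, `shell`, `budget` and the extraction displays are typed at the letter `1`
  (`reprFam T p₀ ρ₀ hρ₀ h0 (fun _ _ => 1) (fun _ _ => one_pos)`) — M2-A's weights are letter-free (`weight_true ∕ weight_false`), IR-102-1's
  `intA_bddMeas` serves any letter;
* ADDED (the ruling's list): `qA qB` (source-uniform quotients per pinned old genealogy = key `k ∈ badGMems …`), `qA_nonneg ∕ qB_nonneg`,
  **`extractA`** — THE DISPLAY for run A, verbatim the ruling: on the window, for every bad key `k`, `Σ_{τ ∈ fibre (kmemA …) T† K k}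
  weight μ RA t τ ≤ qA K k · Σ_{τ ∈ T† K} weight μ RA t τ` (`T† := HIndex.termSet (skelFam T p₀)`) —, **`extractB`** — the same for
  run B = the family at cutoff `K + 1`, IN THE RULING's RUN-B-TERMS FORM «run B's terms through `trunc` onto run A's keys»:
  `Σ_{τ′ ∈ T† (K+1), trunc K τ′ ∈ fibre … K k} weight μ RA t τ′ ≤ qB K k · Σ_{τ′ ∈ T† (K+1)} weight μ RA t τ′` (part 2 converts it to
  `PinnedExtraction`'s run-A-index form `weightB μ RA trunc` by `B16HistoryIndexedTrunc.sum_fibre_aggW_eq` ∕ `sum_aggW_eq (htr K hK)`) —,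
  the majorant letters `V rq` with `0 ≤ V`, `0 < rq < 1`, and **`countA ∕ countB`** — the cell's COUNT in relative currency:
  `Σ_{k ∈ badGMems … K} q K k ≤ V · rq ^ (K − jhalf K)` on the window (`hfrac` is no field: `T4RenewalChains.half_le_sub_jhalf`, `c = 1∕2`);
* KEPT VERBATIM (ruling §4 (3)(i) «keep `intA H2A 𝒮 …`, the flow rows, print's per-step sentences (they feed NE7 ∕ NE7c and the
  identification), `shell`, `budget`, constants»): every other field, in the sibling's order and binder shapes; `Φ ∕ hΦ` stay (idle after
  the φ-rows left) so that the parameter block is the three siblings' `(D C O θv rr d n hn g₀ os cΛ M Φ β₀ p₁ η η' κ κ₂ κᵥ P X 𝒢 μ)`.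
ROAD-READ ∕ DISPLAYED-ONLY.  Part 2's road reads: `l₀ vol l₀_pos vol_pos K₀ T p₀ hp₀ ρ₀ hρ₀ h0 intA H2A 𝒮 trunc htr qA qB qA_nonneg qB_nonneg
extractA extractB V rq hV hrq0 hrq1 countA countB shA shB Wsh shell Cc … s budget sum_r sum_u sum_s sum_s₂` (and `hn`, `F.L` through the key
family); every other row is DISPLAYED ONLY — carried for NE7's budget suppliers, NE7c's shell suppliers, the count's custodians (task
T-g103-1: the PRICE road's currency re-read as a bound on the relative class weight) and the (A1c) identification, none of which is here.
HONEST SCOPE: HYPOTHESES over an ABSTRACT tower family; nothing discharged; what the (A1c) instance OWES of Bałaban's KIND is exactly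
`extractA ∕ extractB` per pinned class (the row's wall H3^NE7b relocated from terms to partial sums — NOT in print: print never pins a
genealogy) + the identification; what is the CELL's is `countA ∕ countB`; ρ UNVALUED; NEEDS-CONSTANT 0; NE7b NOT proved; spine 0∕9.
HONEST DEPENDENCY (cell): continuum YM on T⁴ ⇐ BetaPertH ∧ nine spine estimates (0/9 proved); BetaPertH ⇐ (D1) ∧ (D4) ∧ CAP+tail;
G-an2-4 gates asym, D1 and NE2/3/4.  Unchanged.
-/
open Finset MeasureTheory
open Literature.MathematicalPhysics.QuantumFieldTheory.Balaban1983to89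
open T4PersistenceDictionary T4PersistentHistoryCount T4BankedInduction T4PrintedShapeBanking
open T4WeightBudget T4GlobalDenominator T4LiveClassFibration T4LiveStructureGas T4LiveGasToTerms T4RecordPriceSeam
open T4PartnerMultiplicity T4IndicatorShell T4MatchingAssembly T4MatchingClosure T4MatchingClosureSocket T4Continuum
open T4StabilitySocket T4BranchingRecordsGas T4TaggedShapeBanking T4CanonicalMenus T4RenewalChains
open Summit.QuantumFields.BalabanUV.T4Continuum.PlacementBatch Summit.QuantumFields.BalabanUV.T4Continuum.PlacementSkeleton
open Summit.QuantumFields.BalabanUV.T4Continuum.CountThresholdUniform Summit.QuantumFields.BalabanUV.T4Continuum.CountThresholdExit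
open Summit.QuantumFields.BalabanUV.T4Continuum.CountSeamJunction Summit.QuantumFields.BalabanUV.T4Continuum.LateMergers
open Summit.QuantumFields.BalabanUV.T4Continuum.HistoryFlow Summit.QuantumFields.BalabanUV.T4Continuum.HistoryRegeneration
open Summit.QuantumFields.BalabanUV.T4Continuum.HistoryTables Summit.QuantumFields.BalabanUV.T4Continuum.HistoryAssemblyTrees
open Summit.QuantumFields.BalabanUV.T4Continuum.HistoryAssemblyTerms Summit.QuantumFields.BalabanUV.T4Continuum.HistoryAssemblyPedigree
open Summit.QuantumFields.BalabanUV.T4Continuum.HistoryConstants Summit.QuantumFields.BalabanUV.T4Continuum.HistoryGen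
open Literature.MathematicalPhysics.QuantumFieldTheory.Balaban1983to89.B13ScaleTransfer
open Summit.QuantumFields.BalabanUV.T4Continuum.ZoneSkeleton Summit.QuantumFields.BalabanUV.T4Continuum.HistorySocketTH
open Summit.QuantumFields.BalabanUV.T4Continuum.HistoryCaps Summit.QuantumFields.BalabanUV.T4Continuum.HistoryAssemblyPrice
open Summit.QuantumFields.BalabanUV.T4Continuum.HistoryBankingLE Summit.QuantumFields.BalabanUV.T4Continuum.HistoryExitLE
open Summit.QuantumFields.BalabanUV.T4Continuum.HistoryAssemblyTreesLE Summit.QuantumFields.BalabanUV.T4Continuum.HistoryAssemblyTermsLE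
open Summit.QuantumFields.BalabanUV.T4Continuum.HistoryRealise Summit.QuantumFields.BalabanUV.T4Continuum.HistoryAssemblyRealiseLE
open Summit.QuantumFields.BalabanUV.T4Continuum.HistoryAssemblyMult Summit.QuantumFields.BalabanUV.T4Continuum.HistoryAssemblyMultKey
open Summit.QuantumFields.BalabanUV.T4Continuum.HistoryAssemblyRealiseRun Summit.QuantumFields.BalabanUV.T4Continuum.HistoryAssemblyRealiseMult
open Summit.QuantumFields.BalabanUV.T4Continuum.HistoryZones Summit.QuantumFields.BalabanUV.T4Continuum.HistoryRealiseCells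
open Summit.QuantumFields.BalabanUV.T4Continuum.HistoryRealiseCellsRun Summit.QuantumFields.BalabanUV.T4Continuum.HistoryAssemblyRealiseRunMult
open Summit.QuantumFields.BalabanUV.T4Continuum.HistoryRealiseCellsRunMult Summit.QuantumFields.BalabanUV.T4Continuum.HistoryAssemblyMultInstance
open Summit.QuantumFields.BalabanUV.T4Continuum.HistoryJoinsPlacedMember Summit.QuantumFields.BalabanUV.T4Continuum.PlacementSkeleton
open Summit.QuantumFields.BalabanUV.T4Continuum.HistoryJoinsPlacedMult Summit.QuantumFields.BalabanUV.T4Continuum.HistoryRealiseDistinct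
open Summit.QuantumFields.BalabanUV.T4Continuum.HistoryRegionTemplates Summit.QuantumFields.BalabanUV.T4Continuum.HistoryCaps
open Summit.QuantumFields.BalabanUV.T4Continuum.HistoryZoneEvolve (cth)
open Literature.MathematicalPhysics.QuantumFieldTheory.Balaban1983to89.B16SProfile (DropCtl)
open Summit.QuantumFields.BalabanUV.T4Continuum.HistoryRealiseCellsRunMultEnd Summit.QuantumFields.BalabanUV.T4Continuum.HistoryRealiseCellsRunMultEndD
open Summit.QuantumFields.BalabanUV.T4Continuum.HistoryRealiseCellsRunPinnedT3b Summit.QuantumFields.BalabanUV.T4Continuum.HistoryHybridRescale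
open Summit.QuantumFields.BalabanUV.T4Continuum.HistoryRealiseCellsRunApex (exists_const_schemeZ)
open Summit.QuantumFields.BalabanUV.T4Continuum.HistoryRealisePrint Summit.QuantumFields.BalabanUV.T4Continuum.HistoryRealiseWeak
open Summit.QuantumFields.BalabanUV.T4Continuum.HistoryRealisePrintReading Summit.QuantumFields.BalabanUV.T4Continuum.HistoryRealiseWeakReading
open Summit.QuantumFields.BalabanUV.T4Continuum.HistoryRealisePrintCells Summit.QuantumFields.BalabanUV.T4Continuum.HistoryRealiseWeakCells
open Summit.QuantumFields.BalabanUV.T4Continuum.HistoryRealiseCellsRunApexT3b Summit.QuantumFields.BalabanUV.T4Continuum.HistoryRealiseCellsRunApexT3bW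
open Summit.QuantumFields.BalabanUV.T4Continuum.HistoryRealiseCellsRunApexT3bWT Summit.QuantumFields.BalabanUV.T4Continuum.HistoryRealiseCellsRunPinnedT3bWT
open Summit.QuantumFields.BalabanUV.T4Continuum.HistoryRealiseCellsRunHeadlineT3bWT
open Summit.QuantumFields.BalabanUV.T4Continuum.HistoryRealiseCellsRunApexT3bWTV Summit.QuantumFields.BalabanUV.T4Continuum.HistoryBankingVolumePlug
open Summit.QuantumFields.BalabanUV.T4Continuum.HistoryRealiseCellsRunApexT3bWTVS
open Summit.QuantumFields.BalabanUV.T4Continuum.HistoryGenealogyRealise Summit.QuantumFields.BalabanUV.T4Continuum.HistoryGenealogyInstantiate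
open Summit.QuantumFields.BalabanUV.T4Continuum.B16HistoryIndexedRepr Summit.QuantumFields.BalabanUV.T4Continuum.B16HistoryIndexedTrunc
open Summit.QuantumFields.BalabanUV.T4Continuum.HistoryBankingDiscountCharge Summit.QuantumFields.BalabanUV.T4Continuum.HistoryBankingCreditRead
open Summit.QuantumFields.BalabanUV.T4Continuum.HistoryBankingFibreRoom Summit.QuantumFields.BalabanUV.T4Continuum.HistoryPriceKeys
open Summit.QuantumFields.BalabanUV.T4Continuum.HistoryRealiseCellsRunSupplyWTVS Summit.QuantumFields.BalabanUV.T4Continuum.HistoryRealiseCellsRunSupplyKeysWTVS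
open Summit.QuantumFields.BalabanUV.T4Continuum.HistoryRealiseCellsRunAssemblyWTVSData Summit.QuantumFields.BalabanUV.T4Continuum.HistoryRealiseCellsRunAssemblyWTVSDataL
open Summit.QuantumFields.BalabanUV.T4Continuum.HistoryBankingSharpShares (sBsharp ell)
open Summit.QuantumFields.BalabanUV.T4Continuum.HistoryBankingRoundingUnrounded (sRunr ApFlat)
open Summit.QuantumFields.BalabanUV.T4Continuum.HistoryBankingVolumeWindowLattice (uvolL)
open Literature.MathematicalPhysics.QuantumFieldTheory.Balaban1983to89.TreeLength Literature.MathematicalPhysics.QuantumFieldTheory.Balaban1983to89.B16MergeGeometry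
open Summit.QuantumFields.BalabanUV.T4Continuum.HistoryAdmissible Summit.QuantumFields.BalabanUV.T4Continuum.HistoryGenealogyExtraction
open Summit.QuantumFields.BalabanUV.T4Continuum.HistoryGenealogyPedigree Summit.QuantumFields.BalabanUV.T4Continuum.HistoryTouchComponents
open Summit.QuantumFields.BalabanUV.T4Continuum.B16HistoryReprChain Summit.QuantumFields.BalabanUV.T4Continuum.B16HistoryReprInstance
open Summit.QuantumFields.BalabanUV.T4Continuum.B16HistoryReprRead Summit.QuantumFields.BalabanUV.T4Continuum.B16HistoryReprReadCausal
open Summit.QuantumFields.BalabanUV.T4Continuum.B16HistoryStepDisplayPinned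
open Summit.QuantumFields.BalabanUV.T4Continuum.B16HistoryTowerEndDataLWL
open Literature.MathematicalPhysics.QuantumFieldTheory.Balaban1983to89.B16StepFactorsPrinted
open Literature.MathematicalPhysics.QuantumFieldTheory.Balaban1983to89.B16LargeFieldFactors380 (minConst)
open Summit.QuantumFields.BalabanUV.T4Continuum.B16HistoryStepJunction
open Summit.QuantumFields.BalabanUV.T4Continuum.B16HistoryTowerEndDataLWR
open Summit.QuantumFields.BalabanUV.T4Continuum.B16HistoryTowerEndPrinted
open Summit.QuantumFields.BalabanUV.T4Continuum.HistoryBankingSharpShares (ell)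
open Summit.QuantumFields.BalabanUV.T4Continuum.B16HistoryTowerEndPrintedR
open Summit.QuantumFields.BalabanUV.T4Continuum.B16HistoryTowerEndPrintedRRange

open Summit.QuantumFields.BalabanUV.T4Continuum.B16HistoryTowerStepRangeDataLWR

namespace Summit.QuantumFields.BalabanUV.T4Continuum.B16HistoryTowerExtractionDataLWR

noncomputable section

set_option synthInstance.maxSize 1024

/-! ## §1 The record -/

section Data

variable {F : T4Family} {G : Type*} [GaugeGroup G] [MeasurableSpace G] [HaarData G] [RegularGaugeGroup G]

/-- **THE INPUTS OF THE (α) ASSEMBLY RE-CUT AT THE PER-PINNED-CLASS RELATIVE DISPLAY, BOTH RUNS FROM ONE TOWER FAMILY READ AT PRINT's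
LIVE INDEX** (HYPOTHESIS SHAPE — data + located displays + C-side letters, NOTHING of Bałaban's asserted): `TowerStepRangeDataLWR` with the
dressing sup letters, the (ρ) ∕ envelope ∕ share rows, run B's term-wise rows and the (γ) ∕ site rows STRUCK, the representation letter
pinned at `1`, and the EXTRACTION displays `extractA ∕ extractB` per pinned old genealogy (`PinnedExtraction.ExtractionLaws.extract`'s
shape at the tower's keys) with the cell's COUNT `countA ∕ countB` under the two-rate majorant `V · rq ^ (K − jhalf K)` ADDED; every other
field verbatim. [folklore] -/
structure TowerExtractionDataLWR (D : FiniteEpsData F G) (C : T4PrintedShapeBanking.Consts) (O : PrintedO1s) (θv : ℝ)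
    (rr d n : ℕ) (hn : 0 < n) (g₀ : ℕ → ℝ) (os : List (ULoop F))
    (cΛ M Φ β₀ : ℝ) (p₁ η η' κ κ₂ κᵥ : ℕ)
    (P : Type) [DecidableEq P] (X : ℕ → ℕ → Type) (𝒢 : (K j : ℕ) → GoodClass (X K j))
    [∀ K, MeasurableSpace (X K K)] (μ : (K : ℕ) → Measure (X K K)) [∀ K, IsFiniteMeasure (μ K)] where
  /-- the source radius -/
  l₀ : ℝ
  /-- the volume factor of the matching remainders -/
  vol : ℝ
  /-- the source radius is positive -/
  l₀_pos : 0 < l₀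
  /-- the volume factor is positive -/
  vol_pos : 0 < vol
  /-- the threshold in the number of steps -/
  K₀ : ℕ
  /-- THE TOWER of run A: per cutoff `K`, `K` one-step positive operations branching over the choices (IR-97-2), READ AT PRINT's LIVE
  INDEX (C-ρ-TOWER: second-group 𝐑-outputs and healings inside `op j g p`, (1.98) ∕ (1.101)) -/
  T : (K : ℕ) → Tower P (X K) (𝒢 K)
  /-- the small-field choice at every step of every run -/
  p₀ : ℕ → ℕ → P
  /-- the small-field choice lies on every branch -/
  hp₀ : ∀ K j g, p₀ K j ∈ (T K).branch j g
  /-- the dressed initial densities `ρ₀ K t` (H2's `e^{t·obs}·ρ₀`) -/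
  ρ₀ : (K : ℕ) → ℝ → X K 0 → ℝ
  /-- the dressed initial densities are good -/
  hρ₀ : ∀ K t, (𝒢 K 0).Gd (ρ₀ K t)
  /-- the dressed initial densities are non-negative -/
  h0 : ∀ K t x, 0 ≤ ρ₀ K t x
  /-- display (integrability of the elementary terms of the tower's operations, representation letter `1`) -/
  intA : ∀ K t a, ∀ ι ∈ (skelFam T p₀ K).LIdx a,
    Integrable ((reprFam T p₀ ρ₀ hρ₀ h0 (fun _ _ => 1) (fun _ _ => one_pos) K t).eterm a ι) (μ K)
  /-- display (H2: the dressed push-forward identity, at the tower's final density `densFam`) -/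
  H2A : ∀ K t, |t| ≤ l₀ → K₀ ≤ K →
    ∫ U, Real.exp (t * T4GenFunBounds.prodObs (D.scheme g₀) K os U) * D.dens K (g₀ K) 0 U ∂fieldMeasure (F.P K) 0 G =
      ∫ x, densFam T ρ₀ K t x ∂μ K
  /-- THE STEP READING of the tower's choices (regions, cubes, classes; flow, memory — IR-99-3) -/
  𝒮 : StepReading P d
  /-- (c1) the reading's blocking parameter is the family's -/
  hL : 𝒮.L = F.L
  /-- (c1) the reading's exponent profile is the run's own -/
  hs : 𝒮.s = runProfile F.L 𝒮.R
  /-- the small-field choice names no region -/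
  hν0 : ∀ K j g, 𝒮.ν K j g (p₀ K j) = ∅
  /-- named regions are pointed, face-connected and of tree length at most their class -/
  hν : ∀ K j g p, ∀ nr ∈ 𝒮.ν K j g p, nr.1 ∈ nr.2 ∧ FaceConnected nr.2 ∧ treeLen nr.2 ≤ 𝒮.κ K nr
  /-- flow: memory domination -/
  hRm : ∀ K s k, 𝒮.Rm K s k ≤ 𝒮.R K s
  /-- flow: memory domination, one-step form -/
  hRmS : ∀ K, K₀ ≤ K → ∀ t k, 𝒮.Rm K t (k + 1) ≤ 𝒮.R K (t + 1)
  /-- flow: non-degenerate memory -/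
  hRm2 : ∀ K, K₀ ≤ K → ∀ t, 2 ≤ 𝒮.Rm K t 1
  /-- PRINT-SIDE STEP DATA: print's constants record ([B16] pp. 380–383's O(1)s, `B16StepFactorsPrinted.Consts`) -/
  c : B16StepFactorsPrinted.Consts
  /-- PRINT-SIDE STEP DATA: print's abstract per-step carriers (J4-a `StepData`) per run `K`, step `j`, prefix `g` -/
  Xs : (K j : ℕ) → (Fin j → P) → StepData d P
  /-- C-side (3R-range): print's p. 380 chain constants are non-negative and within the volume letter's constant -/
  (hC' : 0 ≤ c.C') (hC380 : 0 ≤ c.C380) (hcΛc : c.C' + c.C380 ≤ cΛ)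
  /-- flow (3R-range): `1 ≤ ℓ_{j+1}` on the performed range (couplings at most `e^{-1/2}`) -/
  hℓ1 : ∀ K, K₀ ≤ K → ∀ j, j < K → 1 ≤ ell (gsOf D g₀ K) (j + 1)
  /-- tower-side display (β) (J4.2's `hβ`): PAST THE CUTOFF the step maps kill the unit — the natural padding of a `K`-step run -/
  hβ : ∀ K, K₀ ≤ K → ∀ j, K ≤ j → ∀ (g : Fin j → P) (p : P) (x : X K (j + 1)), ((T K).op j g p).T (fun _ => 1) x = 0
  /-- display: PRINT's PER-STEP SENTENCES `StepDisplaysAt` (IR-100-2, all five conjuncts — the ROUNDED (P) included) AT THE CARRIERS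
  READ OFF THE TOWER AND THE PROCESS (`carriersOf`), every run `K ≥ K₀`, PERFORMED step `j < K`, prefix `g` — J4.2's binder verbatim -/
  hdisp : ∀ K, K₀ ≤ K → ∀ j, j < K → ∀ (g : Fin j → P),
    StepDisplaysAt (runsOf D g₀ K) j (carriersOf T 𝒮 (runsOf D g₀ K) K j g (Xs K j g)) c
  /-- display: the `=` CLASS JUNCTION on the performed range (J4.2's `hclass`) -/
  hclass : ∀ K, K₀ ≤ K → ∀ j, j < K → ∀ (g : Fin j → P) (p : P),
    ∀ x ∈ (𝒮.runPartial K (j + 1) (Fin.snoc g p)).histM.newPairs (j + 1),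
      (Xs K j g).dC p x = (𝒮.κ K ((𝒮.runPartial K (j + 1) (Fin.snoc g p)).histM.newAt (j + 1) x) : ℝ)
  /-- display: p. 380's chain, FIRST LINK — the region volume is at most the large-field volume (3R-range's `hΩ`) -/
  hΩ : ∀ K, K₀ ≤ K → ∀ j, j < K → ∀ (g : Fin j → P) (p : P), (Xs K j g).volZΩ p ≤ (Xs K j g).volZ p
  /-- display: p. 380's chain in CUBE-COUNT form — the large-field volume is at most `(M·R_{j+1})^d` per component cube (3R-range's `hcube`) -/
  hcube : ∀ K, K₀ ≤ K → ∀ j, j < K → ∀ (g : Fin j → P) (p : P),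
    (Xs K j g).volZ p ≤
      (M * 𝒮.R K (j + 1)) ^ d * ∑ cc ∈ (𝒮.runPartial K (j + 1) (Fin.snoc g p)).histM.comp (j + 1), ((cc.2).card : ℝ)
  /-- letter table (3R): print's constants record carries the cell's dimension -/
  hd : c.d = O.d
  /-- letter table (3R, (2.5)): print's size profile AT the run's couplings IS the reading's sizes -/
  hR : ∀ K h, c.R (gsOf D g₀ K h) = (𝒮.R K h : ℝ)
  /-- letter table (3R): print's `p₁`-profile is `ℓ^{p₁}` -/
  hP : ∀ K h, c.P1 (gsOf D g₀ K h) = ell (gsOf D g₀ K) h ^ p₁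
  /-- display (2.5): the reading's sizes are admissible for the running couplings -/
  isRj : ∀ K s, s ≤ K → B14.IsRj F.L rr ((D.C ⟨K, F.m, g₀ K⟩).flow.g s) (𝒮.R K s)
  /-- sizes are at least one -/
  one_le_R : ∀ K, K₀ ≤ K → ∀ t, 1 ≤ 𝒮.R K t
  /-- flow (K): the blocking parameter is at least four -/
  hL4 : 4 ≤ F.L
  /-- flow (K): the run's own exponent profile is non-increasing within the run -/
  hprof : ∀ K, K₀ ≤ K → ∀ t, t < K → runProfile F.L 𝒮.R K (t + 1) ≤ runProfile F.L 𝒮.R K t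
  /-- flow (K): drop control of the run's own profile -/
  hdrop : ∀ K, K₀ ≤ K → ∀ m, DropCtl (runProfile F.L 𝒮.R K) m
  /-- pass-V input condition per term: disjoint new regions -/
  hD : ∀ K, K₀ ≤ K → ∀ τ ∈ HIndex.termSet (skelFam T p₀) K, ((𝒮.reading T p₀).inputOf.run K τ).NewDisjoint
  /-- pass-V input condition per term: every new region lies in the torus' period box at its level -/
  hreg : ∀ K, K₀ ≤ K → ∀ τ ∈ HIndex.termSet (skelFam T p₀) K, ((𝒮.reading T p₀).inputOf.run K τ).RegionsInBox n K
  /-- constants: the window constant -/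
  hn₁ : 13 ≤ C.n₁
  /-- constants -/
  hE₂ : 0 < C.E₂
  /-- constants — `E₃` strictly positive -/
  hE₃pos : 0 < C.E₃
  /-- (2.9)∕(2.7)'s letter `β′` -/
  β' : ℝ
  /-- display (2.9) on the reading's sizes -/
  h29 : ∀ K, K₀ ≤ K → B14FlowStep.FlowIneq29 (𝒮.R K) (D.C ⟨K, F.m, g₀ K⟩).flow.g F.L β' β₀ K
  /-- C-side: print's p. 380 volume constant is nonnegative -/
  hcΛ : 0 ≤ cΛ
  /-- C-side: the cube-side letter `M` of the lattice volume letter is nonnegative -/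
  hMΛ : 0 ≤ M
  /-- flow (ADDED): `0 ≤ ℓ_j = log (g^K_j)⁻²` on every run's performed range (couplings at most one) -/
  hℓ : ∀ K j, j ≤ K → 0 ≤ ell (gsOf D g₀ K) j
  /-- RUN B = THE SAME FAMILY AT CUTOFF `K + 1` (S, NODE O): the truncation of the cutoff-`(K+1)` tower's level-`(K+1)` terms onto
  the cutoff-`K` tower's index -/
  trunc : ℕ → HIndex.Idx (skelFam T p₀) → HIndex.Idx (skelFam T p₀)
  /-- display (S): the truncation maps run B's term set into run A's -/
  htr : ∀ K, K₀ ≤ K → ∀ τ' ∈ HIndex.termSet (skelFam T p₀) (K + 1), trunc K τ' ∈ HIndex.termSet (skelFam T p₀) K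
  /-- THE QUOTIENTS of run A: per cutoff and pinned old genealogy (key), source-uniform -/
  qA : ℕ → Finset ((Fin d → ℕ) × Gen PEv × Multiset (PEv × ((Fin d → ℕ) × Finset (Pt d)))) → ℝ
  /-- THE QUOTIENTS of run B, at run A's keys -/
  qB : ℕ → Finset ((Fin d → ℕ) × Gen PEv × Multiset (PEv × ((Fin d → ℕ) × Finset (Pt d)))) → ℝ
  /-- the quotients of run A are non-negative on the bad keys of the window -/
  qA_nonneg : ∀ K, K₀ ≤ K →
    ∀ k ∈ badGMems (memA n F.L (𝒮.reading T p₀)) jhalf (HIndex.termSet (skelFam T p₀))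
        (kmemA n F.L hn (lt_of_lt_of_le (by norm_num) (two_le_L F)) (𝒮.reading T p₀)) K, 0 ≤ qA K k
  /-- the quotients of run B are non-negative on the bad keys of the window -/
  qB_nonneg : ∀ K, K₀ ≤ K →
    ∀ k ∈ badGMems (memA n F.L (𝒮.reading T p₀)) jhalf (HIndex.termSet (skelFam T p₀))
        (kmemA n F.L hn (lt_of_lt_of_le (by norm_num) (two_le_L F)) (𝒮.reading T p₀)) K, 0 ≤ qB K k
  /-- **THE EXTRACTION DISPLAY, run A** (`PinnedExtraction.ExtractionLaws.extract` at the tower's keys; the (A1c) instance OWES it — print's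
  KIND, [Balaban1989LargeFieldII] (1.79)–(1.89) + Thm 1's upper half with the pinned genealogy's operations replaced by their bounds, over
  the SAME run's full sum; NOT print's statement): on the window, the partial sum of M2-A's weights over the fibre of a bad key is at most
  `qA K k` times the full sum -/
  extractA : ∀ K t, |t| ≤ l₀ → K₀ ≤ K →
    ∀ k ∈ badGMems (memA n F.L (𝒮.reading T p₀)) jhalf (HIndex.termSet (skelFam T p₀))
        (kmemA n F.L hn (lt_of_lt_of_le (by norm_num) (two_le_L F)) (𝒮.reading T p₀)) K,
      ∑ τ ∈ fibre (kmemA n F.L hn (lt_of_lt_of_le (by norm_num) (two_le_L F)) (𝒮.reading T p₀))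
          (HIndex.termSet (skelFam T p₀)) K k,
        Repr172R.weight μ (reprFam T p₀ ρ₀ hρ₀ h0 (fun _ _ => 1) (fun _ _ => one_pos)) t τ ≤
      qA K k * ∑ τ ∈ HIndex.termSet (skelFam T p₀) K, Repr172R.weight μ (reprFam T p₀ ρ₀ hρ₀ h0 (fun _ _ => 1) (fun _ _ => one_pos)) t τ
  /-- **THE EXTRACTION DISPLAY, run B = the family at cutoff `K + 1`, THROUGH `trunc` ONTO RUN A's KEYS**: on the window, the partial sum of
  run B's weights over its terms truncating into the fibre of a bad key is at most `qB K k` times run B's full sum -/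
  extractB : ∀ K t, |t| ≤ l₀ → K₀ ≤ K →
    ∀ k ∈ badGMems (memA n F.L (𝒮.reading T p₀)) jhalf (HIndex.termSet (skelFam T p₀))
        (kmemA n F.L hn (lt_of_lt_of_le (by norm_num) (two_le_L F)) (𝒮.reading T p₀)) K,
      ∑ τ' ∈ (HIndex.termSet (skelFam T p₀) (K + 1)).filter (fun τ' =>
          trunc K τ' ∈ fibre (kmemA n F.L hn (lt_of_lt_of_le (by norm_num) (two_le_L F)) (𝒮.reading T p₀))
            (HIndex.termSet (skelFam T p₀)) K k),
        Repr172R.weight μ (reprFam T p₀ ρ₀ hρ₀ h0 (fun _ _ => 1) (fun _ _ => one_pos)) t τ' ≤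
      qB K k * ∑ τ' ∈ HIndex.termSet (skelFam T p₀) (K + 1),
        Repr172R.weight μ (reprFam T p₀ ρ₀ hρ₀ h0 (fun _ _ => 1) (fun _ _ => one_pos)) t τ'
  /-- the two-rate majorant's letters: volume constant `V` and rate `rq` (`T4WeightBudget.summable_weightMajorant`'s `V`, `r`) -/
  (V rq : ℝ)
  /-- the volume constant is non-negative -/
  hV : 0 ≤ V
  /-- the rate is positive -/
  hrq0 : 0 < rq
  /-- the rate is below one -/
  hrq1 : rq < 1
  /-- **THE COUNT, run A** (the cell's banking arithmetic in RELATIVE currency — task T-g103-1; displayed): on the window the quotients of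
  the bad keys total at most `V · rq ^ (K − jhalf K)` -/
  countA : ∀ K, K₀ ≤ K →
    ∑ k ∈ badGMems (memA n F.L (𝒮.reading T p₀)) jhalf (HIndex.termSet (skelFam T p₀))
        (kmemA n F.L hn (lt_of_lt_of_le (by norm_num) (two_le_L F)) (𝒮.reading T p₀)) K, qA K k ≤ V * rq ^ (K - jhalf K)
  /-- **THE COUNT, run B** -/
  countB : ∀ K, K₀ ≤ K →
    ∑ k ∈ badGMems (memA n F.L (𝒮.reading T p₀)) jhalf (HIndex.termSet (skelFam T p₀))
        (kmemA n F.L hn (lt_of_lt_of_le (by norm_num) (two_le_L F)) (𝒮.reading T p₀)) K, qB K k ≤ V * rq ^ (K - jhalf K)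
  /-- NE7c: the two runs' shell parts -/
  (shA shB : ℕ → ℝ → HIndex.Idx (skelFam T p₀) → ℝ)
  /-- NE7c's shell weight budget -/
  Wsh : ℕ → ℝ
  /-- NE7c (S): the indicator shells' relative weight bound over the tower's terms -/
  shell : ShellWeightBound l₀ (HIndex.termSet (skelFam T p₀))
    (fun _ t => Repr172R.weight μ (reprFam T p₀ ρ₀ hρ₀ h0 (fun _ _ => 1) (fun _ _ => one_pos)) t)
    (weightB μ (reprFam T p₀ ρ₀ hρ₀ h0 (fun _ _ => 1) (fun _ _ => one_pos)) trunc) shA shB Wsh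
  /-- NE7 core budget data -/
  (Cc Rr CcRec RrRec : ℕ → ℝ → HIndex.Idx (skelFam T p₀) → ℝ)
  /-- NE7 core budget rates -/
  (ν u s₂ q₀ r s : ℕ → ℝ)
  /-- NE7 (S): the re-indexed per-term budget over the tower reading's bad classes -/
  budget : ReindexedBudget l₀ vol (HIndex.termSet (skelFam T p₀))
    (fun K t τ => Repr172R.weight μ (reprFam T p₀ ρ₀ hρ₀ h0 (fun _ _ => 1) (fun _ _ => one_pos)) t τ - shA K t τ)
    (fun K t τ => weightB μ (reprFam T p₀ ρ₀ hρ₀ h0 (fun _ _ => 1) (fun _ _ => one_pos)) trunc K t τ - shB K t τ)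
    (badOfClass (bstrOf Prod.fst (memA n F.L (𝒮.reading T p₀))) (HIndex.termSet (skelFam T p₀))
      (fun K _ => badClasses Prod.fst (memA n F.L (𝒮.reading T p₀)) jhalf (HIndex.termSet (skelFam T p₀)) K))
    Cc Rr CcRec RrRec ν u s₂ q₀ r s
  /-- summable rates -/
  (sum_r : Summable r) (sum_u : Summable u) (sum_s : Summable s) (sum_s₂ : Summable s₂)
  /-- C-side signs: the volume slack is positive; `β₀, Φ ≥ 0` -/
  (hθv : 0 < θv) (hβ₀ : 0 ≤ β₀) (hΦ : 0 ≤ Φ)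
  /-- C-side: the birth-floor mass letter -/
  m : ℝ
  /-- C-side: `A₁² ≤ m` -/
  hm : O.A₁ ^ 2 ≤ m
  /-- census identity AT PRINT's `t = d+5` ([B16] p. 383 «we assume that 2p₁ − (d+5)r₀ > p₀», the gap named `η`) -/
  hexpR : C.p₀ + rr * (O.d + 5) + η = 2 * p₁
  /-- census identity: `r(q′+1) + r(d+5) + η′ = 2p₁` -/
  hexpR' : rr * (C.q' + 1) + rr * (O.d + 5) + η' = 2 * p₁
  /-- census identity: `r(q′+1) + κ = 2p₀` -/
  hexpB : rr * (C.q' + 1) + κ = 2 * C.p₀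
  /-- census identity in LATTICE units: `1 + κ₂ = r·(q′ − d)` -/
  hexpFL : 1 + κ₂ = rr * (C.q' - d)
  /-- census side condition in LATTICE units: `d ≤ q′` -/
  hdq : d ≤ C.q'
  /-- census identity in LATTICE units: `1 + r·d + κᵥ = 2p₀` -/
  hexpVL : 1 + rr * d + κᵥ = 2 * C.p₀
  /-- exponent gaps -/
  (hη : 1 ≤ η) (hη' : 1 ≤ η') (hκ : 1 ≤ κ) (hκ₂ : 1 ≤ κ₂) (hκᵥ : 1 ≤ κᵥ)
  /-- constants: `1 ≤ p₀` -/
  hp₀c : 1 ≤ C.p₀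
  /-- signs of print's O(1)s -/
  (hγ₀ : 0 < O.γ₀) (hA₁ : O.A₁ ≠ 0) (hA₀ : 0 < C.A₀) (hM : 0 < O.M)
  /-- letter table (part 3 `hsB_of_tables`): print's `γ₀` is the count road's -/
  hγc : c.γ₀ = O.γ₀
  /-- letter table (part 3): print's `A₀` is the count road's -/
  hAc : c.A₀ = C.A₀
  /-- letter table (part 3): print's `p₀` is the count road's -/
  hpc : c.p₀ = C.p₀
  /-- letter table (part 3): the birth-floor mass letter is at most print's p. 381 min-constant `min{½B₃⁻²A₀², 2A₁², A₁²}` -/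
  hmc : m ≤ minConst c.B₃ c.A₀ c.A₁
  /-- (2.7)'s power (NE7-rate row) -/
  p27 : ℕ
  /-- (2.7)'s power is at least one -/
  hp27 : 1 ≤ p27
  /-- display (2.7) per cutoff on the run's couplings -/
  h27 : ∀ K, K₀ ≤ K → B14.FlowIneq27 (D.C ⟨K, F.m, g₀ K⟩).flow.g β' β₀ p27 K

end Data

end

end Summit.QuantumFields.BalabanUV.T4Continuum.B16HistoryTowerExtractionDataLWR
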